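import Literature.MathematicalPhysics.QuantumFieldTheory.Balaban1983to89.B9Thm314GpSqFlatMultiLevelTorus
import Literature.MathematicalPhysics.QuantumFieldTheory.Balaban1983to89.B6Prop23MultiLevelTorus

/-!
# `Balaban1983to89.B9Thm314QGGQInvFlatTransfer` — [B9] THEOREM 3.14 (pp. 426–427, (3.154)) AT `U = 1` FOR
`(Q′G′²Q′*)⁻¹` ON THE GENUINE `k`-LEVEL TORUS, FILE 2 OF 3: THE TRANSFER KERNEL BETWEEN THE TWO BLOCK LATTICES AND THE
ESTIMATE OF ONE SURVIVING TERM — for two nested families `{Ω_j}`, `{Ω′_j}` on one torus, `A = Q′G′[Ω]²Q′*` on `ℝ^{𝔅[Ω]}`,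
`B = Q′G′[Ω′]²Q′*` on `ℝ^{𝔅[Ω′]}` and `T` the identification of the common top blocks,
`A⁻¹(y, y′) − B⁻¹(y, y′) = Σ_{u,v} A⁻¹(y, u)·(TB − AT)(u, v)·B⁻¹(v, y′)` and
`|A⁻¹(y,u)|·|(TB − AT)(u,v)|·|B⁻¹(v,y′)| ≤ K·L^{−4k}·e^{−½δd(y,y′,Ω)}·e^{−¼δd_Ω(y,u)}·e^{−¼δd_{Ω′}(y′,v)}`
(no existing module is touched; no fact is minted; one `def` with body: the transfer kernel)

FRAMING (verbatim cell line):
statement-level skeleton of published theorems with citation tags; proofs where landed; nothing here is a claim about the Yang–Mills mass gap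

Sources under audit (cell pub-balaban / lit-balaban): T. Bałaban, *Propagators for lattice gauge theories in a
background field*, Commun. Math. Phys. **99** (1985) 389–434 [`Balaban1985BackgroundPropagators`, "B9"], pp. 426–427
[PDF 38–39] (Theorem 3.14, (3.154)), p. 398 [PDF 10] (Theorem 3.2 (3.48) and the remark on the powers `L^jη`) — held text
`paper:balaban1985-cmp99-background-propagators` p0038/p0039/p0010 and page scans `1985-cmp99-background-propagators-p038`,
`-p010` read this generation; T. Bałaban, *Propagators and renormalization transformations for lattice gauge theories. II*,
Commun. Math. Phys. **96** (1984) 223–250 [`Balaban1984PropagatorsII`, "[4]"], Prop. 2.3 (2.87) p. 238, (2.68)–(2.69)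
p. 235, (2.60)–(2.61) p. 234, (2.46) p. 231.  Unit `lit-balaban-p21` (Phase-2 proof seat p21 gen 19, HOME
`run/shared/lean/pub/lit-balaban/`, free-target protocol G.5-34(d); B9 fold owner r06, B6 fold owner r03, referee ref-4).

## WHAT IS PRINTED (quotations AS PRINTED; «…» marks our elisions)

B9 p. 426 (scan p038): «We construct operators for both sequences and we define Ω = Ω_k ∩ Ω′_k. Let us take localizations
determined by points y, y′ ∈ Ω^{(k)} (i.e. these are cubes Δ̃(y), Δ̃(y′) in the case of operators G′, G, G₁, 𝔊, the cube
Δ̃(y) and the point y′ in the case of H, H₁, and the points y, y′ in the case of (Q′G′²Q′*)⁻¹, (QGQ*)⁻¹, etc.). We have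
**Theorem 3.14.** If we take a pair of operators constructed for the two sequences {Ω_j}, {Ω′_j}, then their difference
satisfies all the inequalities characteristic for operators of the considered type, with the additional factor
exp(−δ₀d(y, y′, Ω)), d(y, y′, Ω) = inf_{y₁∈Ωᶜ∩T^{(k)}} (|y − y₁| + |y₁ − y′|) (3.154) on the right-hand sides.» (p. 427)
«We take random walk expansions for both operators, and in the difference all terms for walks with localizations
contained in Ω are cancelled. Remaining terms correspond to walks of the general type (3.107), for which at least one
localization X_i intersects Ωᶜ.»  B9 p. 398 (scan p010): «**Theorem 3.2.** Under the assumptions of Theorem 3.1, and with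
the same constants, the following inequality holds: |(Q′(U)G′²(U)Q′*(U))⁻¹(y, y′)| ≤ B₀(L^jη)^{−4}(L^{j′}η)^{−d}e^{−δ₀d(y,y′)},
y, y′ ∈ 𝔅 (y ∈ Λ_j, y′ ∈ Λ_{j′}). (3.48)»; «Next, the choice of powers L^jη is conventional also. Using Lemma 2.1 in [4]
we may replace the factor (L^jη)^α by (L^jη)^β(L^{j′}η)^γ with β + γ = α, j, j′ are indices of localizations.»

## WHAT THIS FILE CERTIFIES (kernel-checked; lattice units `η = 1`; setting of `B9Thm314GpFlatTorusGeometry`)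

For two families `D, D′ : TDomains` on one torus, `A = kerOp W (XkT D a) = Q′G′[D]²Q′*` on `ℝ^{𝔅[D]}` and `B` likewise on
`ℝ^{𝔅[D′]}` (r05՚s (2.69)-kernel `XkT`), `A⁻¹ = GinvT D a`, `B⁻¹ = GinvT D′ a` (the torus Prop. 2.3 inverses of
`B6Prop23MultiLevelTorus`), a COMMON TOP block being a block of level `k` of BOTH families (`u.1.1 = k ∧ u.1 ∈ bset D′`):
* §1 geometry of (3.154) with INTERMEDIATE localisations: `tdistK_triangle`, the two half-triangle inequalities
  `dOmega_le_tdistK_add` / `dOmega_le_add_tdistK` (`d(y,y″,Ω) ≤ |y − y′| + d(y′,y″,Ω)`), `tdistK_le_distT_of_top`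
  (`|y − y′| ≤ d_T(y,y′)` for top blocks), **`dOmega_le_of_witness'`** (one family, one block `b ∋ z` with the `k`-lattice
  point of `z` in `Ωᶜ`: `d(y₀,y₀′,Ω) ≤ d_T(y₀,b) + d_T(b,y₀′) + 2`), and **`exists_OmegaC_of_not_common`** (a block which is
  not a common top block contains a site whose `k`-lattice point is in `Ωᶜ ∩ T^{(k)}` — territories are unions of blocks of
  their own level);
* §2 **`transKer`** — the entries `M(u, v) = [u common top]·B(u, v) − [v common top]·A(u, v)` of `TB − AT`, `T` the
  identification of the common top blocks — and **`mat_inv_sub_eq`**: for common top `y`, `y′`,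
  `A⁻¹(y, y′) − B⁻¹(y, y′) = Σ_{u∈𝔅[D]} Σ_{v∈𝔅[D′]} A⁻¹(y,u)·M(u,v)·B⁻¹(v,y′)` from `A⁻¹A = 1`, `BB⁻¹ = 1` (the algebraic
  form, at `U = 1`, of print's cancellation of the walks inside `Ω`: `M(u, v) = B(u,v) − A(u,v)` when both blocks are
  common top, and otherwise one of the two blocks meets `Ωᶜ`);
* §3 `exp_bookkeeping`, **`transfer_four`** (the (2.60) weight transfer at the fourth power: `L^{4k}·L^{−4j(s)}·e^{−½δd_T(t,s)}
  ≤ L⁴` for a top block `t`, under `L² ≤ e^{¼δ(R·L·M_h − 1)}` — print's remark on the powers `L^jη`), and **`term_le`**: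
  from the (2.87) bounds of `A⁻¹`, `B⁻¹`, the (2.68) bounds of `A`, `B` and the Theorem-3.14 bound of `B − A` on common top
  pairs (file 1 `B9Thm314GpSqFlatMultiLevelTorus.thm314_X_flat_multiLevelTorus`), all at one rate `δ`, for common top `y, y′`
  and ANY `u ∈ 𝔅[D]`, `v ∈ 𝔅[D′]`:
  `|A⁻¹(y,u)|·|M(u,v)|·|B⁻¹(v,y′)| ≤ C_G²(C_Δ + 2C_XL⁴)e^{δ}·L^{−4k}·e^{−½δd(y,y′,Ω)}·e^{−¼δd_D(y,u)}·e^{−¼δd_{D′}(y′,v)}`.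
File 3 (`B9Thm314QGGQInvFlatMultiLevelTorus`) sums this by (2.61) twice and combines it with the trivial bound.

## HONEST SCOPE

* `U = 1` only (no background field; B9 states Theorems 3.2/3.14 for regular `U`), torus lineage of this seat (`Ω₁ = T_η`,
  levels `1 … k`, `A = 0`, `m² = 0`, lattice units, spatial dimension `d + 1`); HYPOTHESIS-LEVEL in the five kernel bounds
  (fed in file 3 from the torus (2.87)/(2.68) packages and file 1).  Only COMMON TOP blocks `y, y′`; (3.154) as in
  `B9Thm314GpFlatTorusGeometry` (`k`-block centres, torus sup-distance in units of `L^k`, `inf ∅ := 0`).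
* ROUTE (declared): print's walk-expansion cancellation is replaced by the transfer-resolvent identity §2 (the inverse of
  `B6Prop23MultiLevelTorus` is obtained by [3] Sect. 5 on the whole block lattice, not by the expansion (2.86)); the
  surviving terms are classified by which of `u`, `v` is a common top block, exactly as print's «at least one localization
  X_i intersects Ωᶜ».  Nothing is inferred from the manuscript: every step is kernel-checked; the quoted sentences locate
  the statements.
-/

namespace Literature.MathematicalPhysics.QuantumFieldTheory.Balaban1983to89.B9Thm314QGGQInvFlatTransfer

open Finset Matrix
open Literature.MathematicalPhysics.QuantumFieldTheory.Balaban1983to89.B4Reflection242 (boxDom blk)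
open Literature.MathematicalPhysics.QuantumFieldTheory.Balaban1983to89.B6MultiLevelBoxOperator
open Literature.MathematicalPhysics.QuantumFieldTheory.Balaban1983to89.B6MultiLevelTorusOperator
open Literature.MathematicalPhysics.QuantumFieldTheory.Balaban1983to89.B6Geom246MultiLevelBox
open Literature.MathematicalPhysics.QuantumFieldTheory.Balaban1983to89.B6Geom246MultiLevelTorus
open Literature.MathematicalPhysics.QuantumFieldTheory.Balaban1983to89.B8Ineq192MultiLevelTorus (geomTB geomTB_dist
  geomTB_L geomTB_RM geomTB_RM_nonneg levelSepTB lenT_eq symmT symmTB XkT W_eq_lenT_pow lenT_pos)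
open Literature.MathematicalPhysics.QuantumFieldTheory.Balaban1983to89.B6Lemma21Repaired (Ineq261With)
open Literature.MathematicalPhysics.QuantumFieldTheory.Balaban1983to89.B6Ineq268 (ratio mx ratio_mul_exp_le LevelSep)
open Literature.MathematicalPhysics.QuantumFieldTheory.Balaban1983to89.B6Ineq243TwoLevelBox (aNext)
open Literature.MathematicalPhysics.QuantumFieldTheory.Balaban1983to89.B9Thm314GpFlatTorusGeometry
open Literature.MathematicalPhysics.QuantumFieldTheory.Balaban1983to89.B9Thm314GpFlatResolvent (blkOf_eq_iff_blkOf_eq)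
open Literature.MathematicalPhysics.QuantumFieldTheory.Balaban1983to89.B9Thm314GpFlatMultiLevelTorus (combined_bound
  consts_260_261)
open Literature.MathematicalPhysics.QuantumFieldTheory.Balaban1983to89.B9Thm314GpSqFlatMultiLevelTorus
  (thm314_X_flat_multiLevelTorus W_common)
open Literature.MathematicalPhysics.QuantumFieldTheory.Balaban1983to89.B6Ineq268MultiLevelBox (W W_pos W_eq)
open Literature.MathematicalPhysics.QuantumFieldTheory.Balaban1983to89.B6Ineq268MultiLevelTorus (ineq268_multiLevelTorus)
open Literature.MathematicalPhysics.QuantumFieldTheory.Balaban1983to89.B6Prop23MultiLevelTorus (GinvT prop23_multiLevelTorus)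
open Literature.MathematicalPhysics.QuantumFieldTheory.Balaban1983to89.B6Prop23Chain (mat mat_kerOp mat_mul mat_sub)
open Literature.MathematicalPhysics.QuantumFieldTheory.Balaban1983to89.B6Expansion282 (kerOp)

noncomputable section

variable {d : ℕ}

/-! ## §1 Geometry of (3.154) for arbitrary intermediate blocks: triangle inequalities and the `Ωᶜ` witnesses -/

section Geometry

variable {ℓ Mh k R : ℕ} {P : Fin (d + 1) → ℕ} (D D' : TDomains d ℓ Mh k P R)

omit D D' in
/-- `|y − y″| ≤ |y − y′| + |y′ − y″|` on `T^{(k)}` (the torus sup-distance of `k`-block centres in units of `L^k`).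
[cite: Balaban1985BackgroundPropagators, (3.154) p.427, dictionary] -/
theorem tdistK_triangle (β β' β'' : Fin (d + 1) → ℤ) :
    tdistK (ℓ := ℓ) (Mh := Mh) (k := k) (P := P) β β''
      ≤ tdistK (ℓ := ℓ) (Mh := Mh) (k := k) (P := P) β β' + tdistK (ℓ := ℓ) (Mh := Mh) (k := k) (P := P) β' β'' := by
  unfold tdistK
  rw [← add_div]
  exact div_le_div_of_nonneg_right (dist_triangle _ _ _) (by positivity)

omit D D' in
/-- `|y − y′| = |y′ − y|` on `T^{(k)}`. [cite: Balaban1985BackgroundPropagators, (3.154) p.427, dictionary] -/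
theorem tdistK_comm (β β' : Fin (d + 1) → ℤ) :
    tdistK (ℓ := ℓ) (Mh := Mh) (k := k) (P := P) β β' = tdistK (ℓ := ℓ) (Mh := Mh) (k := k) (P := P) β' β := by
  unfold tdistK; rw [dist_comm]

/-- **`d(y, y″, Ω) ≤ |y − y′| + d(y′, y″, Ω)`** (the infimum (3.154) moved along `T^{(k)}`).
[cite: Balaban1985BackgroundPropagators, (3.154) p.427] -/
theorem dOmega_le_tdistK_add (β β' β'' : Fin (d + 1) → ℤ) :
    dOmega D D' β β'' ≤ tdistK (ℓ := ℓ) (Mh := Mh) (k := k) (P := P) β β' + dOmega D D' β' β'' := by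
  unfold dOmega
  split_ifs with h
  · obtain ⟨β₁, hβ₁, hmin⟩ := Finset.exists_mem_eq_inf' h
      (fun β₁ => tdistK (ℓ := ℓ) (Mh := Mh) (k := k) (P := P) β' β₁ + tdistK (ℓ := ℓ) (Mh := Mh) (k := k) (P := P) β₁ β'')
    rw [hmin]
    refine (Finset.inf'_le _ hβ₁).trans ?_
    have := tdistK_triangle (ℓ := ℓ) (Mh := Mh) (k := k) (P := P) β β' β₁
    linarith
  · rw [add_zero]; exact tdistK_nonneg _ _

/-- **`d(y, y″, Ω) ≤ d(y, y′, Ω) + |y′ − y″|`**. [cite: Balaban1985BackgroundPropagators, (3.154) p.427] -/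
theorem dOmega_le_add_tdistK (β β' β'' : Fin (d + 1) → ℤ) :
    dOmega D D' β β'' ≤ dOmega D D' β β' + tdistK (ℓ := ℓ) (Mh := Mh) (k := k) (P := P) β' β'' := by
  unfold dOmega
  split_ifs with h
  · obtain ⟨β₁, hβ₁, hmin⟩ := Finset.exists_mem_eq_inf' h
      (fun β₁ => tdistK (ℓ := ℓ) (Mh := Mh) (k := k) (P := P) β β₁ + tdistK (ℓ := ℓ) (Mh := Mh) (k := k) (P := P) β₁ β')
    rw [hmin]
    refine (Finset.inf'_le _ hβ₁).trans ?_
    have := tdistK_triangle (ℓ := ℓ) (Mh := Mh) (k := k) (P := P) β₁ β' β''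
    linarith
  · rw [zero_add]; exact tdistK_nonneg _ _

omit D D' in
/-- **`|y − y′| ≤ d_T(y, y′)` FOR TOP BLOCKS** of one family (positions of top blocks are the `k`-block centres; file 1
`dist_posT_le_mul_distT`). [cite: Balaban1984PropagatorsII, (2.46) p.231; Balaban1985BackgroundPropagators, (3.154) p.427] -/
theorem tdistK_le_distT_of_top (D₀ : TDomains d ℓ Mh k P R) (hMh : 1 ≤ Mh) (hP : ∀ μ, 1 ≤ P μ)
    {y u : ↥(bset D₀.toDomains)} (hy : y.1.1 = k) (hu : u.1.1 = k) :
    tdistK (ℓ := ℓ) (Mh := Mh) (k := k) (P := P) y.1.2 u.1.2 ≤ (geomT D₀).dist y u := by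
  have h := dist_posT_le_mul_distT D₀ hMh hP y u
  rw [posT_eq_of_top D₀ hy, posT_eq_of_top D₀ hu] at h
  unfold tdistK
  rw [div_le_iff₀ (by positivity)]
  exact h

/-- **ONE INTERMEDIATE LOCALISATION IN `Ωᶜ`, ONE FAMILY**: for top blocks `y₀, y₀′` and a block `b` of the SAME family
`D₀` containing a site `z` whose `k`-lattice point lies in `Ωᶜ ∩ T^{(k)}`:
`d(y₀, y₀′, Ω) ≤ d_{D₀}(y₀, b) + d_{D₀}(b, y₀′) + 2` (`y₁ :=` the `k`-lattice point of `z`; `|y₀ − y₁|`, `|y₁ − y₀′|` along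
`y₀ → b ∋ z → y₀′` by `|· − ·|_T ≤ L^k·d_T` and the block radii). [cite: Balaban1985BackgroundPropagators, Thm 3.14 (3.154) p.427 («at least one localization X_i intersects Ωᶜ»)] -/
theorem dOmega_le_of_witness' (D₀ : TDomains d ℓ Mh k P R) (hMh : 1 ≤ Mh) (hP : ∀ μ, 1 ≤ P μ)
    {y₀ b y₀' : ↥(bset D₀.toDomains)} (hy₀ : y₀.1.1 = k) (hy₀' : y₀'.1.1 = k) {z : ↥(boxDom (N0 ℓ Mh k P))}
    (hz : blkOf D₀.toDomains z = b) (hΩ : blk ((ℓ + 1) ^ k) z.1 ∈ OmegaC D D') :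
    dOmega D D' y₀.1.2 y₀'.1.2 ≤ (geomT D₀).dist y₀ b + (geomT D₀).dist b y₀' + 2 := by
  have hN : ∀ i, 1 ≤ N0 ℓ Mh k P i := one_le_N0 hMh hP
  set Lk : ℝ := (((ℓ + 1) ^ k : ℕ) : ℝ) with hLk
  have hLk1 : 1 ≤ Lk := by rw [hLk]; exact_mod_cast Nat.one_le_pow _ _ (by omega)
  have hLk0 : 0 < Lk := lt_of_lt_of_le one_pos hLk1
  refine (dOmega_le D D' hΩ).trans ?_
  have epy : toT (N0 ℓ Mh k P) (cenLab ((ℓ + 1) ^ k) y₀.1.2) = posT D₀ y₀ := (posT_eq_of_top D₀ hy₀).symm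
  have epy' : toT (N0 ℓ Mh k P) (cenLab ((ℓ + 1) ^ k) y₀'.1.2) = posT D₀ y₀' := (posT_eq_of_top D₀ hy₀').symm
  have epc : toT (N0 ℓ Mh k P) (cenLab ((ℓ + 1) ^ k) (blk ((ℓ + 1) ^ k) z.1))
      = toT (N0 ℓ Mh k P) (cenB ((ℓ + 1) ^ k) z.1) := rfl
  have hLb : (((ℓ + 1) ^ b.1.1 : ℕ) : ℝ) ≤ Lk := powL_mono_real (scale_bounds D₀.toDomains b).2
  have h_bz : dist (posT D₀ b) (toT (N0 ℓ Mh k P) (toR z.1)) ≤ Lk / 2 := by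
    have h := dist_site_posT_le (D := D₀) hz
    rw [dist_comm] at h
    linarith
  have h_zc : dist (toT (N0 ℓ Mh k P) (toR z.1)) (toT (N0 ℓ Mh k P) (cenB ((ℓ + 1) ^ k) z.1)) ≤ Lk / 2 := by
    have h := (dist_toT_le hN (toR z.1) (cenB ((ℓ + 1) ^ k) z.1)).trans
      (dist_toR_cenB_le (Nat.one_le_pow _ _ (by omega)) z.1)
    refine h.trans ?_
    rw [hLk]; linarith
  have h_yb : dist (posT D₀ y₀) (posT D₀ b) ≤ (geomT D₀).dist y₀ b * Lk := dist_posT_le_mul_distT D₀ hMh hP y₀ b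
  have h_by' : dist (posT D₀ b) (posT D₀ y₀') ≤ (geomT D₀).dist b y₀' * Lk := dist_posT_le_mul_distT D₀ hMh hP b y₀'
  have leg1 : dist (posT D₀ y₀) (toT (N0 ℓ Mh k P) (cenB ((ℓ + 1) ^ k) z.1)) ≤ ((geomT D₀).dist y₀ b + 1) * Lk := by
    calc dist (posT D₀ y₀) (toT (N0 ℓ Mh k P) (cenB ((ℓ + 1) ^ k) z.1))
        ≤ dist (posT D₀ y₀) (posT D₀ b) + dist (posT D₀ b) (toT (N0 ℓ Mh k P) (toR z.1))
            + dist (toT (N0 ℓ Mh k P) (toR z.1)) (toT (N0 ℓ Mh k P) (cenB ((ℓ + 1) ^ k) z.1)) :=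
          dist_triangle4 _ _ _ _
      _ ≤ (geomT D₀).dist y₀ b * Lk + Lk / 2 + Lk / 2 := by linarith
      _ = ((geomT D₀).dist y₀ b + 1) * Lk := by ring
  have leg2 : dist (toT (N0 ℓ Mh k P) (cenB ((ℓ + 1) ^ k) z.1)) (posT D₀ y₀') ≤ ((geomT D₀).dist b y₀' + 1) * Lk := by
    have hcz : dist (toT (N0 ℓ Mh k P) (cenB ((ℓ + 1) ^ k) z.1)) (toT (N0 ℓ Mh k P) (toR z.1)) ≤ Lk / 2 := by
      rw [dist_comm]; exact h_zc
    have hzb : dist (toT (N0 ℓ Mh k P) (toR z.1)) (posT D₀ b) ≤ Lk / 2 := by rw [dist_comm]; exact h_bz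
    calc dist (toT (N0 ℓ Mh k P) (cenB ((ℓ + 1) ^ k) z.1)) (posT D₀ y₀')
        ≤ dist (toT (N0 ℓ Mh k P) (cenB ((ℓ + 1) ^ k) z.1)) (toT (N0 ℓ Mh k P) (toR z.1))
            + dist (toT (N0 ℓ Mh k P) (toR z.1)) (posT D₀ b) + dist (posT D₀ b) (posT D₀ y₀') := dist_triangle4 _ _ _ _
      _ ≤ Lk / 2 + Lk / 2 + (geomT D₀).dist b y₀' * Lk := by linarith
      _ = ((geomT D₀).dist b y₀' + 1) * Lk := by ring
  unfold tdistK
  rw [epy, epy', epc, ← hLk, ← add_div, div_le_iff₀ hLk0]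
  nlinarith [leg1, leg2]

/-- **A BLOCK WHICH IS NOT A COMMON TOP BLOCK MEETS `Ωᶜ`**: if the block `v` of `𝔅[D₁]` is not a top block of BOTH families
(`¬(j(v) = k ∧ v ∈ 𝔅[D₂])`), then some site of `v` has its `k`-lattice point in `Ωᶜ ∩ T^{(k)}` (territories are unions of
blocks of their own level). [cite: Balaban1984PropagatorsII, (2.1) p.224; Balaban1985BackgroundPropagators, (3.154) p.427] -/
theorem exists_OmegaC_of_not_common (v : ↥(bset D'.toDomains)) (hv : ¬ (v.1.1 = k ∧ v.1 ∈ bset D.toDomains)) :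
    ∃ z : ↥(boxDom (N0 ℓ Mh k P)), blkOf D'.toDomains z = v ∧ blk ((ℓ + 1) ^ k) z.1 ∈ OmegaC D D' := by
  obtain ⟨z, hz⟩ := exists_blkOf_eq D'.toDomains v
  refine ⟨z, hz, blk_mem_OmegaC D D' ?_⟩
  rintro ⟨h1, h2⟩
  apply hv
  have hlev : D'.lev z.1 = v.1.1 := by
    have h := lev_eq_of_blkOf_eq D'.toDomains hz
    rw [TDomains.toDomains_lev] at h
    exact h
  have hvk : v.1.1 = k := hlev.symm.trans h2
  refine ⟨hvk, ?_⟩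
  have hlab : blk ((ℓ + 1) ^ k) z.1 = v.1.2 := by
    have h := (blkOf_eq_iff_blk D'.toDomains).1 hz
    rw [hvk] at h
    exact h
  have hu : (blkOf D.toDomains z).1 = v.1 := by
    rw [blkOf_val]
    refine Prod.ext ?_ ?_
    · show D.toDomains.lev z.1 = v.1.1
      rw [TDomains.toDomains_lev, h1, hvk]
    · show blk ((ℓ + 1) ^ D.toDomains.lev z.1) z.1 = v.1.2
      rw [TDomains.toDomains_lev, h1, hlab]
  rw [← hu]
  exact (blkOf D.toDomains z).2

/-- … the same with the roles of the two families exchanged. [cite: Balaban1984PropagatorsII, (2.1) p.224; Balaban1985BackgroundPropagators, (3.154) p.427] -/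
theorem exists_OmegaC_of_not_common' (u : ↥(bset D.toDomains)) (hu : ¬ (u.1.1 = k ∧ u.1 ∈ bset D'.toDomains)) :
    ∃ z : ↥(boxDom (N0 ℓ Mh k P)), blkOf D.toDomains z = u ∧ blk ((ℓ + 1) ^ k) z.1 ∈ OmegaC D D' := by
  obtain ⟨z, hz, hΩ⟩ := exists_OmegaC_of_not_common D' D u hu
  refine ⟨z, hz, ?_⟩
  rw [mem_OmegaC_iff_exists] at hΩ ⊢
  obtain ⟨x, hx, hne⟩ := hΩ
  exact ⟨x, hx, fun h => hne ⟨h.2, h.1⟩⟩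

end Geometry

/-! ## §2 The transfer kernel `M = T·B − A·T` between the two block lattices and the identity
`A⁻¹(y, y′) − B⁻¹(y, y′) = Σ_{u,v} A⁻¹(y, u)·M(u, v)·B⁻¹(v, y′)` -/

section Transfer

variable {ℓ Mh k R : ℕ} {P : Fin (d + 1) → ℕ} (D D' : TDomains d ℓ Mh k P R) (a : ℕ → ℝ)

open Classical in
/-- **THE TRANSFER KERNEL** between `𝔅[D]` and `𝔅[D′]`: with `A = Q′G′[D]²Q′*`, `B = Q′G′[D′]²Q′*` (as operators `kerOp W X`
in point masses) and `T` the identification of the COMMON TOP blocks (top level in both families),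
`M(u, v) = [u common top]·B(u, v) − [v common top]·A(u, v)` = the entries of `T·B − A·T`.
[cite: Balaban1985BackgroundPropagators, Thm 3.14 p.427 («in the difference all terms for walks with localizations contained in Ω are cancelled»), dictionary] -/
def transKer (u : ↥(bset D.toDomains)) (v : ↥(bset D'.toDomains)) : ℝ :=
  (if h : u.1.1 = k ∧ u.1 ∈ bset D'.toDomains
    then mat (kerOp (W D'.toDomains) (XkT D' a)) ⟨u.1, h.2⟩ v else 0)
  - (if h : v.1.1 = k ∧ v.1 ∈ bset D.toDomains
    then mat (kerOp (W D.toDomains) (XkT D a)) u ⟨v.1, h.2⟩ else 0)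

/-- the matrix of the identity operator is the identity matrix. [folklore] -/
private theorem mat_one {S : Type} [DecidableEq S] (u v : S) : mat (1 : Module.End ℝ (S → ℝ)) u v = if u = v then 1 else 0 := by
  unfold mat; rw [Module.End.one_apply, Pi.single_apply]

/-- **THE TRANSFER-RESOLVENT IDENTITY, ENTRYWISE**: for common top blocks `y`, `y′` (read in `𝔅[D]` resp. `𝔅[D′]`),
`A⁻¹(y, y′) − B⁻¹(y, y′) = Σ_{u∈𝔅[D]} Σ_{v∈𝔅[D′]} A⁻¹(y, u)·M(u, v)·B⁻¹(v, y′)` — from `A⁻¹A = 1` on `ℝ^{𝔅[D]}` and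
`BB⁻¹ = 1` on `ℝ^{𝔅[D′]}` (the algebraic form, at `U = 1`, of the cancellation of the walks inside `Ω`).
[cite: Balaban1985BackgroundPropagators, Thm 3.14 p.427; Balaban1984PropagatorsII, Prop. 2.3 p.238] -/
theorem mat_inv_sub_eq (h1 : GinvT D a * kerOp (W D.toDomains) (XkT D a) = 1)
    (h2 : kerOp (W D'.toDomains) (XkT D' a) * GinvT D' a = 1)
    (y : ↥(bset D.toDomains)) (hy : y.1.1 = k ∧ y.1 ∈ bset D'.toDomains)
    (y' : ↥(bset D'.toDomains)) (hy' : y'.1.1 = k ∧ y'.1 ∈ bset D.toDomains) :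
    mat (GinvT D a) y ⟨y'.1, hy'.2⟩ - mat (GinvT D' a) ⟨y.1, hy.2⟩ y'
      = ∑ u : ↥(bset D.toDomains), ∑ v : ↥(bset D'.toDomains),
          mat (GinvT D a) y u * transKer D D' a u v * mat (GinvT D' a) v y' := by
  classical
  -- the first half: `Σ_u A⁻¹(y,u)[u cc] Σ_v B(u,v)B⁻¹(v,y′) = A⁻¹(y, y′)`
  have hT1 : ∀ u : ↥(bset D.toDomains),
      (∑ v, (if h : u.1.1 = k ∧ u.1 ∈ bset D'.toDomains
          then mat (kerOp (W D'.toDomains) (XkT D' a)) ⟨u.1, h.2⟩ v else 0) * mat (GinvT D' a) v y')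
        = if u = ⟨y'.1, hy'.2⟩ then 1 else 0 := by
    intro u
    by_cases hu : u.1.1 = k ∧ u.1 ∈ bset D'.toDomains
    · simp only [dif_pos hu]
      rw [← mat_mul, h2, mat_one]
      have e : ((⟨u.1, hu.2⟩ : ↥(bset D'.toDomains)) = y') ↔ (u = ⟨y'.1, hy'.2⟩) := by
        constructor
        · intro h; apply Subtype.ext; have h1 := congrArg Subtype.val h; exact h1
        · intro h; apply Subtype.ext; have h1 := congrArg Subtype.val h; exact h1
      by_cases h' : u = ⟨y'.1, hy'.2⟩
      · rw [if_pos h', if_pos (e.2 h')]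
      · rw [if_neg h', if_neg (fun h => h' (e.1 h))]
    · simp only [dif_neg hu, zero_mul, Finset.sum_const_zero]
      have h' : u ≠ ⟨y'.1, hy'.2⟩ := by
        rintro rfl
        exact hu ⟨hy'.1, y'.2⟩
      rw [if_neg h']
  -- the second half: `Σ_v [v cc] (Σ_u A⁻¹(y,u)A(u,v)) B⁻¹(v,y′) = B⁻¹(y, y′)`
  have hT2 : ∀ v : ↥(bset D'.toDomains),
      (∑ u, mat (GinvT D a) y u * (if h : v.1.1 = k ∧ v.1 ∈ bset D.toDomains
          then mat (kerOp (W D.toDomains) (XkT D a)) u ⟨v.1, h.2⟩ else 0))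
        = if v = ⟨y.1, hy.2⟩ then 1 else 0 := by
    intro v
    by_cases hv : v.1.1 = k ∧ v.1 ∈ bset D.toDomains
    · simp only [dif_pos hv]
      rw [← mat_mul, h1, mat_one]
      have e : (y = (⟨v.1, hv.2⟩ : ↥(bset D.toDomains))) ↔ (v = ⟨y.1, hy.2⟩) := by
        constructor
        · intro h; apply Subtype.ext; have h1 := congrArg Subtype.val h; exact h1.symm
        · intro h; apply Subtype.ext; have h1 := congrArg Subtype.val h; exact h1.symm
      by_cases h' : v = ⟨y.1, hy.2⟩
      · rw [if_pos h', if_pos (e.2 h')]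
      · rw [if_neg h', if_neg (fun h => h' (e.1 h))]
    · simp only [dif_neg hv, mul_zero, Finset.sum_const_zero]
      have h' : v ≠ ⟨y.1, hy.2⟩ := by
        rintro rfl
        exact hv ⟨hy.1, y.2⟩
      rw [if_neg h']
  -- assemble
  have hsplit : ∑ u : ↥(bset D.toDomains), ∑ v : ↥(bset D'.toDomains),
        mat (GinvT D a) y u * transKer D D' a u v * mat (GinvT D' a) v y'
      = (∑ u, mat (GinvT D a) y u *
          ∑ v, (if h : u.1.1 = k ∧ u.1 ∈ bset D'.toDomains
            then mat (kerOp (W D'.toDomains) (XkT D' a)) ⟨u.1, h.2⟩ v else 0) * mat (GinvT D' a) v y')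
        - ∑ v, (∑ u, mat (GinvT D a) y u * (if h : v.1.1 = k ∧ v.1 ∈ bset D.toDomains
            then mat (kerOp (W D.toDomains) (XkT D a)) u ⟨v.1, h.2⟩ else 0)) * mat (GinvT D' a) v y' := by
    unfold transKer
    simp only [mul_sub, sub_mul, Finset.sum_sub_distrib, Finset.mul_sum, Finset.sum_mul]
    congr 1
    · exact Finset.sum_congr rfl fun u _ => Finset.sum_congr rfl fun v _ => by ring
    · rw [Finset.sum_comm]
  rw [hsplit]
  simp_rw [hT1, hT2]
  simp [Finset.sum_ite_eq']

end Transfer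

/-! ## §3 The estimate of the double sum: three kinds of surviving terms, (2.60) transfer, (2.61) twice -/

section Bounds

variable {ℓ Mh k R : ℕ} {P : Fin (d + 1) → ℕ} (D D' : TDomains d ℓ Mh k P R) (a : ℕ → ℝ)

omit D D' a in
/-- the exponential bookkeeping of one surviving term: if `d(y, y′, Ω) ≤ d₁ + d₂ + d₃ + 2` then
`e^{−δd₁}·e^{−½δd₂}·e^{−δd₃} ≤ e^{δ}·e^{−½δ·d(y,y′,Ω)}·(e^{−¼δd₁}·e^{−¼δd₃})` (half of the outer rates kept for the (2.61)
sums). [cite: Balaban1985BackgroundPropagators, Thm 3.14 (3.154) p.427 («after adjusting a definition of δ₀»), bookkeeping] -/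
theorem exp_bookkeeping {δ d₁ d₂ d₃ dΩ : ℝ} (hδ : 0 ≤ δ) (h₁ : 0 ≤ d₁) (h₃ : 0 ≤ d₃)
    (hΩ : dΩ ≤ d₁ + d₂ + d₃ + 2) :
    Real.exp (-(δ * d₁)) * Real.exp (-(δ / 2 * d₂)) * Real.exp (-(δ * d₃))
      ≤ Real.exp δ * Real.exp (-(δ / 2 * dΩ)) * (Real.exp (-(δ / 4 * d₁)) * Real.exp (-(δ / 4 * d₃))) := by
  rw [← Real.exp_add, ← Real.exp_add, ← Real.exp_add, ← Real.exp_add, ← Real.exp_add, Real.exp_le_exp]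
  nlinarith [mul_le_mul_of_nonneg_left hΩ hδ, mul_nonneg hδ h₁, mul_nonneg hδ h₃]

omit D D' a in
/-- **THE (2.60) WEIGHT TRANSFER, POWER FOUR**: for a top block `t` and any block `s` of one family,
`L^{4k}·(L^{4j(s)})⁻¹·e^{−½δd(t, s)} ≤ L⁴` once `L² ≤ e^{¼δ(R·L·M_h − 1)}` (the square of `transfer_top`; B9 p. 398: «the
choice of powers L^jη is conventional also. Using Lemma 2.1 in [4] we may replace the factor (L^jη)^α by
(L^jη)^β(L^{j′}η)^γ with β + γ = α»). [cite: Balaban1985BackgroundPropagators, p.398; Balaban1984PropagatorsII, (2.60) p.234, p.235] -/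
theorem transfer_four (D₀ : TDomains d ℓ Mh k P R) (hMh : 1 ≤ Mh) (hP : ∀ μ, 1 ≤ P μ)
    (hRM : 1 ≤ R * ((ℓ + 1) * Mh)) {δ : ℝ} (hδ : 0 ≤ δ)
    (hthr : ((ℓ : ℝ) + 1) ^ 2 ≤ Real.exp (1 / 4 * δ * ((R : ℝ) * (((ℓ : ℝ) + 1) * Mh) - 1)))
    (s t : ↥(bset D₀.toDomains)) (ht : t.1.1 = k) :
    ((ℓ : ℝ) + 1) ^ (4 * k) * (((ℓ : ℝ) + 1) ^ (4 * s.1.1))⁻¹ * Real.exp (-(δ / 2 * (geomT D₀).dist t s))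
      ≤ ((ℓ : ℝ) + 1) ^ 4 := by
  have h := B9Thm314GpFlatResolvent.transfer_top D₀ hMh hP hRM hδ hthr s t ht
  have h0 : 0 ≤ ((ℓ : ℝ) + 1) ^ (2 * k) / ((ℓ : ℝ) + 1) ^ (2 * s.1.1) * Real.exp (-(1 / 4 * δ * (geomT D₀).dist s t)) := by
    positivity
  have h2 := pow_le_pow_left₀ h0 h 2
  rw [symmT D₀ t s]
  have e : (((ℓ : ℝ) + 1) ^ (2 * k) / ((ℓ : ℝ) + 1) ^ (2 * s.1.1) * Real.exp (-(1 / 4 * δ * (geomT D₀).dist s t))) ^ 2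
      = ((ℓ : ℝ) + 1) ^ (4 * k) * (((ℓ : ℝ) + 1) ^ (4 * s.1.1))⁻¹ * Real.exp (-(δ / 2 * (geomT D₀).dist s t)) := by
    rw [mul_pow, div_pow, ← pow_mul, ← pow_mul, pow_two (Real.exp _), ← Real.exp_add, div_eq_mul_inv]
    congr 2 <;> ring_nf
  rw [e, ← pow_mul] at h2
  exact h2

/-- **ONE TERM OF THE DOUBLE SUM.**  HYPOTHESES (all at one rate `δ`): the (2.87) bounds of `A⁻¹ = (Q′G′[D]²Q′*)⁻¹` and
`B⁻¹` in point masses (`|A⁻¹(y, u)| ≤ C_G·L^{−4j(y)}·e^{−δd_D(y,u)}`), the (2.68) bounds of `A`, `B`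
(`|A(u, v)| ≤ C_X·L^{4j(u)}·e^{−δd_D(u,v)}`), the Theorem-3.14 bound of `B − A` on common top pairs
(`≤ C_Δ·L^{4k}·e^{−δd(u,v,Ω)}`, file 1), and the (2.60)-threshold.  CONCLUSION: for common top blocks `y`, `y′` and ANY
`u ∈ 𝔅[D]`, `v ∈ 𝔅[D′]`:
`|A⁻¹(y,u)|·|M(u,v)|·|B⁻¹(v,y′)| ≤ C_G²(C_Δ + 2C_XL⁴)e^{δ}·L^{−4k}·e^{−½δd(y,y′,Ω)}·e^{−¼δd_D(y,u)}·e^{−¼δd_{D′}(y′,v)}`: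
if both `u`, `v` are common top blocks the middle factor is the file-1 difference; if exactly one is, the other block
meets `Ωᶜ` (`exists_OmegaC_of_not_common`) and §1's witness inequality gives the (3.154) factor, the scale mismatch
`L^{4(k−j(v))}` being paid by `transfer_four`; if neither is, the term vanishes.
[cite: Balaban1985BackgroundPropagators, Thm 3.14 (3.154) pp.426–427; Balaban1984PropagatorsII, (2.68) p.235, (2.87) p.238, (2.60) p.234] -/
theorem term_le (hMh : 1 ≤ Mh) (hP : ∀ μ, 1 ≤ P μ) (hRM : 1 ≤ R * ((ℓ + 1) * Mh)) {CG CX CΔ δ : ℝ}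
    (hCG : 0 ≤ CG) (hCX : 0 ≤ CX) (hCΔ : 0 ≤ CΔ) (hδ : 0 ≤ δ)
    (hGi : ∀ y u : ↥(bset D.toDomains), |mat (GinvT D a) y u|
      ≤ CG * (((ℓ : ℝ) + 1) ^ (4 * y.1.1))⁻¹ * Real.exp (-(δ * (geomT D).dist y u)))
    (hGi' : ∀ v y' : ↥(bset D'.toDomains), |mat (GinvT D' a) v y'|
      ≤ CG * (((ℓ : ℝ) + 1) ^ (4 * v.1.1))⁻¹ * Real.exp (-(δ * (geomT D').dist v y')))
    (hX : ∀ u v : ↥(bset D.toDomains), |mat (kerOp (W D.toDomains) (XkT D a)) u v|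
      ≤ CX * ((ℓ : ℝ) + 1) ^ (4 * u.1.1) * Real.exp (-(δ * (geomT D).dist u v)))
    (hX' : ∀ u v : ↥(bset D'.toDomains), |mat (kerOp (W D'.toDomains) (XkT D' a)) u v|
      ≤ CX * ((ℓ : ℝ) + 1) ^ (4 * u.1.1) * Real.exp (-(δ * (geomT D').dist u v)))
    (hΔ : ∀ (u : ↥(bset D.toDomains)) (v : ↥(bset D'.toDomains)) (hu : u.1.1 = k ∧ u.1 ∈ bset D'.toDomains)
      (hv : v.1.1 = k ∧ v.1 ∈ bset D.toDomains),
      |mat (kerOp (W D'.toDomains) (XkT D' a)) ⟨u.1, hu.2⟩ v - mat (kerOp (W D.toDomains) (XkT D a)) u ⟨v.1, hv.2⟩|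
        ≤ CΔ * ((ℓ : ℝ) + 1) ^ (4 * k) * Real.exp (-(δ * dOmega D D' u.1.2 v.1.2)))
    (hthr : ((ℓ : ℝ) + 1) ^ 2 ≤ Real.exp (1 / 4 * δ * ((R : ℝ) * (((ℓ : ℝ) + 1) * Mh) - 1)))
    {y : ↥(bset D.toDomains)} (hy : y.1.1 = k ∧ y.1 ∈ bset D'.toDomains)
    {y' : ↥(bset D'.toDomains)} (hy' : y'.1.1 = k ∧ y'.1 ∈ bset D.toDomains)
    (u : ↥(bset D.toDomains)) (v : ↥(bset D'.toDomains)) :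
    |mat (GinvT D a) y u| * |transKer D D' a u v| * |mat (GinvT D' a) v y'|
      ≤ CG ^ 2 * (CΔ + 2 * CX * ((ℓ : ℝ) + 1) ^ 4) * (Real.exp δ * (((ℓ : ℝ) + 1) ^ (4 * k))⁻¹
          * Real.exp (-(δ / 2 * dOmega D D' y.1.2 y'.1.2))
          * (Real.exp (-(δ / 4 * (geomT D).dist y u)) * Real.exp (-(δ / 4 * (geomT D').dist y' v)))) := by
  classical
  have hL1 : (1 : ℝ) ≤ (ℓ : ℝ) + 1 := by linarith [(Nat.cast_nonneg ℓ : (0 : ℝ) ≤ ℓ)]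
  have hL0 : (0 : ℝ) < (ℓ : ℝ) + 1 := by positivity
  have hd0 : ∀ s t : ↥(bset D.toDomains), 0 ≤ (geomT D).dist s t := (triangle_refl_nonneg_T D hMh hP).2.2
  have hd0' : ∀ s t : ↥(bset D'.toDomains), 0 ≤ (geomT D').dist s t := (triangle_refl_nonneg_T D' hMh hP).2.2
  have hΩ0 : ∀ β β', 0 ≤ dOmega D D' β β' := dOmega_nonneg D D'
  have hL4k0 : (0 : ℝ) < ((ℓ : ℝ) + 1) ^ (4 * k) := by positivity
  have hL4kne : ((ℓ : ℝ) + 1) ^ (4 * k) ≠ 0 := hL4k0.ne'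
  -- the common final shape `Z` is monotone in the middle constant
  have hZ0 : 0 ≤ Real.exp δ * (((ℓ : ℝ) + 1) ^ (4 * k))⁻¹ * Real.exp (-(δ / 2 * dOmega D D' y.1.2 y'.1.2))
      * (Real.exp (-(δ / 4 * (geomT D).dist y u)) * Real.exp (-(δ / 4 * (geomT D').dist y' v))) := by positivity
  have hshape : ∀ {K : ℝ}, K ≤ CΔ + 2 * CX * ((ℓ : ℝ) + 1) ^ 4 →
      CG ^ 2 * K * (Real.exp δ * (((ℓ : ℝ) + 1) ^ (4 * k))⁻¹ * Real.exp (-(δ / 2 * dOmega D D' y.1.2 y'.1.2))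
          * (Real.exp (-(δ / 4 * (geomT D).dist y u)) * Real.exp (-(δ / 4 * (geomT D').dist y' v))))
        ≤ CG ^ 2 * (CΔ + 2 * CX * ((ℓ : ℝ) + 1) ^ 4) * (Real.exp δ * (((ℓ : ℝ) + 1) ^ (4 * k))⁻¹
          * Real.exp (-(δ / 2 * dOmega D D' y.1.2 y'.1.2))
          * (Real.exp (-(δ / 4 * (geomT D).dist y u)) * Real.exp (-(δ / 4 * (geomT D').dist y' v)))) :=
    fun hK => mul_le_mul_of_nonneg_right (mul_le_mul_of_nonneg_left hK (sq_nonneg _)) hZ0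
  -- the two outer legs at the top rows
  have hGy : |mat (GinvT D a) y u| ≤ CG * (((ℓ : ℝ) + 1) ^ (4 * k))⁻¹ * Real.exp (-(δ * (geomT D).dist y u)) := by
    have h := hGi y u; rw [hy.1] at h; exact h
  have hsymm' : (geomT D').dist v y' = (geomT D').dist y' v := symmT D' v y'
  by_cases hu : u.1.1 = k ∧ u.1 ∈ bset D'.toDomains <;> by_cases hv : v.1.1 = k ∧ v.1 ∈ bset D.toDomains
  · -- both common top: the file-1 difference in the middle
    have hM : |transKer D D' a u v| ≤ CΔ * ((ℓ : ℝ) + 1) ^ (4 * k) * Real.exp (-(δ * dOmega D D' u.1.2 v.1.2)) := by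
      unfold transKer; rw [dif_pos hu, dif_pos hv]; exact hΔ u v hu hv
    have hGv : |mat (GinvT D' a) v y'| ≤ CG * (((ℓ : ℝ) + 1) ^ (4 * k))⁻¹ * Real.exp (-(δ * (geomT D').dist y' v)) := by
      have h := hGi' v y'; rw [hv.1, hsymm'] at h; exact h
    -- geometry: `d(y,y′,Ω) ≤ d_D(y,u) + 2d(u,v,Ω) + d_{D′}(y′,v) + 2`
    have ht1 := tdistK_le_distT_of_top D hMh hP hy.1 hu.1
    have ht2 := tdistK_le_distT_of_top D' hMh hP hy'.1 hv.1
    have hΩ : dOmega D D' y.1.2 y'.1.2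
        ≤ (geomT D).dist y u + 2 * dOmega D D' u.1.2 v.1.2 + (geomT D').dist y' v + 2 := by
      have h1 := dOmega_le_tdistK_add D D' y.1.2 u.1.2 y'.1.2
      have h2 := dOmega_le_add_tdistK D D' u.1.2 v.1.2 y'.1.2
      have h3 : tdistK (ℓ := ℓ) (Mh := Mh) (k := k) (P := P) v.1.2 y'.1.2 ≤ (geomT D').dist y' v := by
        rw [tdistK_comm]; exact ht2
      have := hΩ0 u.1.2 v.1.2
      linarith
    have hbook := exp_bookkeeping (d₂ := 2 * dOmega D D' u.1.2 v.1.2) hδ (hd0 y u) (hd0' y' v) hΩ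
    have e2 : Real.exp (-(δ / 2 * (2 * dOmega D D' u.1.2 v.1.2))) = Real.exp (-(δ * dOmega D D' u.1.2 v.1.2)) := by
      congr 1; ring
    rw [e2] at hbook
    calc |mat (GinvT D a) y u| * |transKer D D' a u v| * |mat (GinvT D' a) v y'|
        ≤ (CG * (((ℓ : ℝ) + 1) ^ (4 * k))⁻¹ * Real.exp (-(δ * (geomT D).dist y u)))
            * (CΔ * ((ℓ : ℝ) + 1) ^ (4 * k) * Real.exp (-(δ * dOmega D D' u.1.2 v.1.2)))
            * (CG * (((ℓ : ℝ) + 1) ^ (4 * k))⁻¹ * Real.exp (-(δ * (geomT D').dist y' v))) :=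
          mul_le_mul (mul_le_mul hGy hM (abs_nonneg _) (by positivity)) hGv (abs_nonneg _) (by positivity)
      _ = CG ^ 2 * CΔ * ((((ℓ : ℝ) + 1) ^ (4 * k))⁻¹
            * (Real.exp (-(δ * (geomT D).dist y u)) * Real.exp (-(δ * dOmega D D' u.1.2 v.1.2))
              * Real.exp (-(δ * (geomT D').dist y' v))))
            * (((ℓ : ℝ) + 1) ^ (4 * k) * (((ℓ : ℝ) + 1) ^ (4 * k))⁻¹) := by ring
      _ = CG ^ 2 * CΔ * ((((ℓ : ℝ) + 1) ^ (4 * k))⁻¹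
            * (Real.exp (-(δ * (geomT D).dist y u)) * Real.exp (-(δ * dOmega D D' u.1.2 v.1.2))
              * Real.exp (-(δ * (geomT D').dist y' v)))) := by rw [mul_inv_cancel₀ hL4kne, mul_one]
      _ ≤ CG ^ 2 * CΔ * ((((ℓ : ℝ) + 1) ^ (4 * k))⁻¹
            * (Real.exp δ * Real.exp (-(δ / 2 * dOmega D D' y.1.2 y'.1.2))
              * (Real.exp (-(δ / 4 * (geomT D).dist y u)) * Real.exp (-(δ / 4 * (geomT D').dist y' v))))) :=
          mul_le_mul_of_nonneg_left (mul_le_mul_of_nonneg_left hbook (by positivity)) (by positivity)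
      _ = CG ^ 2 * CΔ * (Real.exp δ * (((ℓ : ℝ) + 1) ^ (4 * k))⁻¹ * Real.exp (-(δ / 2 * dOmega D D' y.1.2 y'.1.2))
            * (Real.exp (-(δ / 4 * (geomT D).dist y u)) * Real.exp (-(δ / 4 * (geomT D').dist y' v)))) := by ring
      _ ≤ _ := hshape (le_add_of_nonneg_right (by positivity))
  · -- `u` common top, `v` not: the middle factor is `B(u, v)`, `v` meets `Ωᶜ`
    have hM : |transKer D D' a u v| ≤ CX * ((ℓ : ℝ) + 1) ^ (4 * k) * Real.exp (-(δ * (geomT D').dist ⟨u.1, hu.2⟩ v)) := by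
      unfold transKer; rw [dif_pos hu, dif_neg hv, sub_zero]
      obtain ⟨hu1, hu2⟩ := hu
      have h := hX' ⟨u.1, hu2⟩ v
      have e : (⟨u.1, hu2⟩ : ↥(bset D'.toDomains)).1.1 = k := hu1
      rw [e] at h; exact h
    have hGv : |mat (GinvT D' a) v y'| ≤ CG * (((ℓ : ℝ) + 1) ^ (4 * v.1.1))⁻¹ * Real.exp (-(δ * (geomT D').dist y' v)) := by
      have h := hGi' v y'; rw [hsymm'] at h; exact h
    -- the witness in `v` and the (3.154) factor along `y → u → v ∋ z → y′`
    obtain ⟨z, hz, hzΩ⟩ := exists_OmegaC_of_not_common D D' v hv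
    have hw := dOmega_le_of_witness' D D' D' hMh hP (y₀ := ⟨u.1, hu.2⟩) (y₀' := y') hu.1 hy'.1 hz hzΩ
    have ht1 := tdistK_le_distT_of_top D hMh hP hy.1 hu.1
    have hΩ : dOmega D D' y.1.2 y'.1.2
        ≤ (geomT D).dist y u + (geomT D').dist ⟨u.1, hu.2⟩ v + (geomT D').dist y' v + 2 := by
      have h1 := dOmega_le_tdistK_add D D' y.1.2 u.1.2 y'.1.2
      have e : (⟨u.1, hu.2⟩ : ↥(bset D'.toDomains)).1.2 = u.1.2 := rfl
      rw [e, symmT D' v y'] at hw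
      linarith
    have hbook := exp_bookkeeping hδ (hd0 y u) (hd0' y' v) hΩ
    -- the weight transfer `L^{4k}/L^{4j(v)}·e^{−½δd′(u,v)} ≤ L⁴`
    have htr := transfer_four D' hMh hP hRM hδ hthr v ⟨u.1, hu.2⟩ hu.1
    have hsplit : Real.exp (-(δ * (geomT D').dist ⟨u.1, hu.2⟩ v))
        = Real.exp (-(δ / 2 * (geomT D').dist ⟨u.1, hu.2⟩ v)) * Real.exp (-(δ / 2 * (geomT D').dist ⟨u.1, hu.2⟩ v)) := by
      rw [← Real.exp_add]; congr 1; ring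
    have hv0 : 0 < ((ℓ : ℝ) + 1) ^ (4 * v.1.1) := by positivity
    calc |mat (GinvT D a) y u| * |transKer D D' a u v| * |mat (GinvT D' a) v y'|
        ≤ (CG * (((ℓ : ℝ) + 1) ^ (4 * k))⁻¹ * Real.exp (-(δ * (geomT D).dist y u)))
            * (CX * ((ℓ : ℝ) + 1) ^ (4 * k) * Real.exp (-(δ * (geomT D').dist ⟨u.1, hu.2⟩ v)))
            * (CG * (((ℓ : ℝ) + 1) ^ (4 * v.1.1))⁻¹ * Real.exp (-(δ * (geomT D').dist y' v))) :=
          mul_le_mul (mul_le_mul hGy hM (abs_nonneg _) (by positivity)) hGv (abs_nonneg _) (by positivity)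
      _ = CG ^ 2 * CX * ((((ℓ : ℝ) + 1) ^ (4 * k))⁻¹
            * ((((ℓ : ℝ) + 1) ^ (4 * k) * (((ℓ : ℝ) + 1) ^ (4 * v.1.1))⁻¹
                * Real.exp (-(δ / 2 * (geomT D').dist ⟨u.1, hu.2⟩ v)))
            * (Real.exp (-(δ * (geomT D).dist y u)) * Real.exp (-(δ / 2 * (geomT D').dist ⟨u.1, hu.2⟩ v))
              * Real.exp (-(δ * (geomT D').dist y' v))))) := by
          rw [hsplit]; ring
      _ ≤ CG ^ 2 * CX * ((((ℓ : ℝ) + 1) ^ (4 * k))⁻¹ * (((ℓ : ℝ) + 1) ^ 4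
            * (Real.exp δ * Real.exp (-(δ / 2 * dOmega D D' y.1.2 y'.1.2))
              * (Real.exp (-(δ / 4 * (geomT D).dist y u)) * Real.exp (-(δ / 4 * (geomT D').dist y' v)))))) := by
          refine mul_le_mul_of_nonneg_left (mul_le_mul_of_nonneg_left ?_ (by positivity)) (by positivity)
          exact mul_le_mul htr hbook (by positivity) (by positivity)
      _ = CG ^ 2 * (CX * ((ℓ : ℝ) + 1) ^ 4) * (Real.exp δ * (((ℓ : ℝ) + 1) ^ (4 * k))⁻¹
            * Real.exp (-(δ / 2 * dOmega D D' y.1.2 y'.1.2))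
            * (Real.exp (-(δ / 4 * (geomT D).dist y u)) * Real.exp (-(δ / 4 * (geomT D').dist y' v)))) := by ring
      _ ≤ _ := hshape (by nlinarith [pow_nonneg hL0.le 4, hCΔ])
  · -- `u` not common top, `v` common top: the middle factor is `A(u, v)`, `u` meets `Ωᶜ`
    have hM : |transKer D D' a u v| ≤ CX * ((ℓ : ℝ) + 1) ^ (4 * k) * Real.exp (-(δ * (geomT D).dist u ⟨v.1, hv.2⟩)) := by
      unfold transKer; rw [dif_neg hu, dif_pos hv, zero_sub, abs_neg]
      refine (hX u ⟨v.1, hv.2⟩).trans ?_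
      refine mul_le_mul_of_nonneg_right (mul_le_mul_of_nonneg_left ?_ hCX) (Real.exp_pos _).le
      exact pow_le_pow_right₀ hL1 (Nat.mul_le_mul_left 4 (scale_bounds D.toDomains u).2)
    have hGv : |mat (GinvT D' a) v y'| ≤ CG * (((ℓ : ℝ) + 1) ^ (4 * k))⁻¹ * Real.exp (-(δ * (geomT D').dist y' v)) := by
      have h := hGi' v y'; rw [hv.1, hsymm'] at h; exact h
    obtain ⟨z, hz, hzΩ⟩ := exists_OmegaC_of_not_common' D D' u hu
    have hw := dOmega_le_of_witness' D D' D hMh hP (y₀ := y) (y₀' := ⟨v.1, hv.2⟩) hy.1 hv.1 hz hzΩ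
    have ht2 := tdistK_le_distT_of_top D' hMh hP hy'.1 hv.1
    have hΩ : dOmega D D' y.1.2 y'.1.2
        ≤ (geomT D).dist y u + (geomT D).dist u ⟨v.1, hv.2⟩ + (geomT D').dist y' v + 2 := by
      have h2 := dOmega_le_add_tdistK D D' y.1.2 v.1.2 y'.1.2
      have h3 : tdistK (ℓ := ℓ) (Mh := Mh) (k := k) (P := P) v.1.2 y'.1.2 ≤ (geomT D').dist y' v := by
        rw [tdistK_comm]; exact ht2
      have e : (⟨v.1, hv.2⟩ : ↥(bset D.toDomains)).1.2 = v.1.2 := rfl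
      rw [e] at hw
      linarith
    have hbook := exp_bookkeeping hδ (hd0 y u) (hd0' y' v) hΩ
    have hhalf : Real.exp (-(δ * (geomT D).dist u ⟨v.1, hv.2⟩)) ≤ Real.exp (-(δ / 2 * (geomT D).dist u ⟨v.1, hv.2⟩)) :=
      Real.exp_le_exp.2 (by nlinarith [hd0 u ⟨v.1, hv.2⟩])
    calc |mat (GinvT D a) y u| * |transKer D D' a u v| * |mat (GinvT D' a) v y'|
        ≤ (CG * (((ℓ : ℝ) + 1) ^ (4 * k))⁻¹ * Real.exp (-(δ * (geomT D).dist y u)))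
            * (CX * ((ℓ : ℝ) + 1) ^ (4 * k) * Real.exp (-(δ * (geomT D).dist u ⟨v.1, hv.2⟩)))
            * (CG * (((ℓ : ℝ) + 1) ^ (4 * k))⁻¹ * Real.exp (-(δ * (geomT D').dist y' v))) :=
          mul_le_mul (mul_le_mul hGy hM (abs_nonneg _) (by positivity)) hGv (abs_nonneg _) (by positivity)
      _ = CG ^ 2 * CX * ((((ℓ : ℝ) + 1) ^ (4 * k))⁻¹
            * (Real.exp (-(δ * (geomT D).dist y u)) * Real.exp (-(δ * (geomT D).dist u ⟨v.1, hv.2⟩))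
              * Real.exp (-(δ * (geomT D').dist y' v))))
            * (((ℓ : ℝ) + 1) ^ (4 * k) * (((ℓ : ℝ) + 1) ^ (4 * k))⁻¹) := by ring
      _ = CG ^ 2 * CX * ((((ℓ : ℝ) + 1) ^ (4 * k))⁻¹
            * (Real.exp (-(δ * (geomT D).dist y u)) * Real.exp (-(δ * (geomT D).dist u ⟨v.1, hv.2⟩))
              * Real.exp (-(δ * (geomT D').dist y' v)))) := by rw [mul_inv_cancel₀ hL4kne, mul_one]
      _ ≤ CG ^ 2 * CX * ((((ℓ : ℝ) + 1) ^ (4 * k))⁻¹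
            * (Real.exp (-(δ * (geomT D).dist y u)) * Real.exp (-(δ / 2 * (geomT D).dist u ⟨v.1, hv.2⟩))
              * Real.exp (-(δ * (geomT D').dist y' v)))) := by
          refine mul_le_mul_of_nonneg_left (mul_le_mul_of_nonneg_left ?_ (by positivity)) (by positivity)
          exact mul_le_mul_of_nonneg_right (mul_le_mul_of_nonneg_left hhalf (Real.exp_pos _).le) (Real.exp_pos _).le
      _ ≤ CG ^ 2 * CX * ((((ℓ : ℝ) + 1) ^ (4 * k))⁻¹
            * (Real.exp δ * Real.exp (-(δ / 2 * dOmega D D' y.1.2 y'.1.2))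
              * (Real.exp (-(δ / 4 * (geomT D).dist y u)) * Real.exp (-(δ / 4 * (geomT D').dist y' v))))) :=
          mul_le_mul_of_nonneg_left (mul_le_mul_of_nonneg_left hbook (by positivity)) (by positivity)
      _ = CG ^ 2 * CX * (Real.exp δ * (((ℓ : ℝ) + 1) ^ (4 * k))⁻¹ * Real.exp (-(δ / 2 * dOmega D D' y.1.2 y'.1.2))
            * (Real.exp (-(δ / 4 * (geomT D).dist y u)) * Real.exp (-(δ / 4 * (geomT D').dist y' v)))) := by ring
      _ ≤ _ := hshape (by nlinarith [one_le_pow₀ (n := 4) hL1, hCΔ, hCX])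
  · -- neither: the term vanishes
    have hM : transKer D D' a u v = 0 := by unfold transKer; rw [dif_neg hu, dif_neg hv, sub_zero]
    rw [hM, abs_zero, mul_zero, zero_mul]
    positivity

end Bounds

end

end Literature.MathematicalPhysics.QuantumFieldTheory.Balaban1983to89.B9Thm314QGGQInvFlatTransfer
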